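import Summits.CriticalPhenomena.PercolationContinuityZ3.Theorems.PercNearOneGluingAdditiveGluingAL5TwoRelaysTools
import HarnessLib

/-! # Crux `PercNearOneGluing.AdditiveGluing` (stmt-CriticalPhenomena-4576) — AL5 for EVERY block with TWO relay neighbours

Support file (`--supports stmt-CriticalPhenomena-4576`; task png-dp-al5); no definitions, no named facts.  Notation of
`…AL5Layers.lean`: `μ_w = prodBernoulli w`, target `b`, bystander `x`, glued block
`w^S := fun e => if e ∈ S.image (s(x,·)) then 1 else w e`, `R = {ω | ∃ a ∈ T, s(x,a) ∈ ω}`.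

**Theorem (`al5_twoRelays`).**  Let `T = {a₁, a₂}` and suppose the bystander `x` has, in `w`, no edge of positive weight
except possibly `e₁ = s(x,a₁)`, `e₂ = s(x,a₂)` (in particular the block star `x–S` is VIRTUAL: weight `0` in `w`, as for a
block glued from scratch).  If `τ_w(d) ≤ τ_w(a₁)` and `τ_w(d) ≤ τ_w(a₂)` then, for EVERY block `S`,
`μ_{w^S}(R ∩ {d ↔ b}) ≤ μ_{w^S}(R ∩ {x ↔ b})`.

This is the first rung of the AL5 ladder beyond the reach of the monotone arguments (it covers the "double-negative /
glued-drift" instances of the task notes, where `d` overtakes both the glued block and every relay).  PROOF (re-weighting):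
write `p_i = w(e_i)`, `π = p₁p₂`.  (1) By one-edge conditioning the AL5 margin is
`p₁p₂Δ¹¹ + p₁(1−p₂)Δ¹⁰ + (1−p₁)p₂Δ⁰¹`, where `Δ^{στ} = μ(x ↔ b) − μ(d ↔ b)` under the glued weighting with `(e₁,e₂)`
pinned to `(σ,τ)` — quantities independent of `(p₁,p₂)` (`al5_twoEdge_real_inter_R`).  (2) Since `x` is otherwise
isolated, `τ_w(v) = π τ¹¹(v) + (1−π) τ⁰⁰(v)` for `v ≠ x` (`al5_twoEdge_tau`): the hypotheses depend on `(p₁,p₂)` only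
through `π`, so they also hold for the re-weightings `w¹ = (e₁,e₂ ↦ 1,π)` and `w² = (e₁,e₂ ↦ π,1)`.  (3) The single-layer
inequality `al5_layer` (iterated KN Lemma 5) at `w¹` for `a₁`, at `w²` for `a₂`, and at `w¹` for `a₂` give
`L₁ = πΔ¹¹ + (1−π)Δ¹⁰ ≥ 0`, `L₂ = πΔ¹¹ + (1−π)Δ⁰¹ ≥ 0`, `πΔ¹¹ ≥ 0`.  (4) The identity
`(1−π)·margin = p₁(1−p₂)L₁ + p₂(1−p₁)L₂ + (1−p₁)(1−p₂)πΔ¹¹` finishes (for `π = 1` the margin is `Δ¹¹`).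
[cite: KozmaNitzan2024, Lemma 5 (p. 13), Lemma 3 (pp. 6–7)]
-/

namespace Summit.CriticalPhenomena.PercolationContinuityZ3.Theorems

open MeasureTheory Set
open Literature.Probability.LatticeModels (prodBernoulli)
open Literature.Probability.Percolation (BondConfig openConn openConnIn openGraph openEdgeCluster pinW localCylinder)

noncomputable section
open Classical

section AL5TwoRelays

open Filter Topology Literature.Probability.LatticeModels Literature.Probability.Percolation

variable {n : ℕ}

/-- **AL5 for every block with two relay neighbours** (see the module docstring).  Hypotheses: the bystander `x` has no
pair of positive weight in `w` other than `s(x,a₁)`, `s(x,a₂)` (so the block star is virtual in `w`), `a₁, a₂ ∉ S`,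
`d, b ≠ x`, and `τ_w(d) ≤ τ_w(a_i)` (`i = 1,2`).  Conclusion: with `w^S` the glued star at `x` and
`R = {some edge s(x,a), a ∈ {a₁,a₂}, open}`, `μ_{w^S}(R ∩ {d ↔ b}) ≤ μ_{w^S}(R ∩ {x ↔ b})`.
[cite: KozmaNitzan2024, Lemma 5 (p. 13), Lemma 3 (pp. 6–7)] -/
theorem al5_twoRelays (w : Sym2 (Fin n) → unitInterval) (S : Finset (Fin n)) (x d b a₁ a₂ : Fin n)
    (hS : ∀ y ∈ S, y ≠ x) (ha₁x : a₁ ≠ x) (ha₂x : a₂ ≠ x) (h₁₂ : a₁ ≠ a₂) (ha₁S : a₁ ∉ S) (ha₂S : a₂ ∉ S)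
    (hdx : d ≠ x) (hbx : b ≠ x)
    (hx : ∀ u : Fin n, u ≠ x → u ≠ a₁ → u ≠ a₂ → w s(x, u) = 0)
    (hle₁ : (prodBernoulli w).real (openConn d b) ≤ (prodBernoulli w).real (openConn a₁ b))
    (hle₂ : (prodBernoulli w).real (openConn d b) ≤ (prodBernoulli w).real (openConn a₂ b)) :
    (prodBernoulli (fun e : Sym2 (Fin n) => if e ∈ S.image (fun y => s(x, y)) then 1 else w e)).real
        ({ω : Set (Sym2 (Fin n)) | ∃ a ∈ ({a₁, a₂} : Finset (Fin n)), s(x, a) ∈ ω} ∩ openConn d b) ≤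
      (prodBernoulli (fun e : Sym2 (Fin n) => if e ∈ S.image (fun y => s(x, y)) then 1 else w e)).real
        ({ω : Set (Sym2 (Fin n)) | ∃ a ∈ ({a₁, a₂} : Finset (Fin n)), s(x, a) ∈ ω} ∩ openConn x b) := by
  have hne : s(x, a₁) ≠ s(x, a₂) := by
    intro h
    rcases Sym2.eq_iff.1 h with ⟨-, h2⟩ | ⟨h1, -⟩
    · exact h₁₂ h2
    · exact ha₂x h1.symm
  have himg : ∀ a : Fin n, a ∉ S → s(x, a) ∉ S.image (fun y => s(x, y)) := by
    intro a haS hmem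
    obtain ⟨y, hyS, hy⟩ := Finset.mem_image.1 hmem
    rcases Sym2.eq_iff.1 hy with ⟨-, h2⟩ | ⟨-, h2⟩
    · exact haS (h2 ▸ hyS)
    · exact hS y hyS h2
  -- the product weight `π = p₁ p₂` as a point of `[0,1]`
  set π : unitInterval := ⟨(w s(x, a₁) : ℝ) * (w s(x, a₂) : ℝ),
    unitInterval.mul_mem (w s(x, a₁)).2 (w s(x, a₂)).2⟩ with hπ
  have hπv : (π : ℝ) = (w s(x, a₁) : ℝ) * (w s(x, a₂) : ℝ) := rfl
  -- the glued weighting and the two re-weightings (glued)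
  set gS : Sym2 (Fin n) → unitInterval := fun e => if e ∈ S.image (fun y => s(x, y)) then 1 else w e with hgS
  set w1 : Sym2 (Fin n) → unitInterval := fun e => if e = s(x, a₁) then 1 else if e = s(x, a₂) then π else w e
    with hw1
  set w2 : Sym2 (Fin n) → unitInterval := fun e => if e = s(x, a₁) then π else if e = s(x, a₂) then 1 else w e
    with hw2
  set g1 : Sym2 (Fin n) → unitInterval := fun e => if e ∈ S.image (fun y => s(x, y)) then 1 else w1 e with hg1
  set g2 : Sym2 (Fin n) → unitInterval := fun e => if e ∈ S.image (fun y => s(x, y)) then 1 else w2 e with hg2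
  -- the three pinned glued weightings (common to `gS`, `g1`, `g2`)
  set g11 : Sym2 (Fin n) → unitInterval :=
    fun e => if e = s(x, a₁) then 1 else if e = s(x, a₂) then 1 else gS e with hg11
  set g10 : Sym2 (Fin n) → unitInterval :=
    fun e => if e = s(x, a₁) then 1 else if e = s(x, a₂) then 0 else gS e with hg10
  set g01 : Sym2 (Fin n) → unitInterval :=
    fun e => if e = s(x, a₁) then 0 else if e = s(x, a₂) then 1 else gS e with hg01
  have hpin : ∀ (g : Sym2 (Fin n) → unitInterval), (∀ e, e ≠ s(x, a₁) → e ≠ s(x, a₂) → g e = gS e) →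
      ∀ σ τ : unitInterval, (fun e => if e = s(x, a₁) then σ else if e = s(x, a₂) then τ else g e) =
        fun e => if e = s(x, a₁) then σ else if e = s(x, a₂) then τ else gS e := by
    intro g hg σ τ
    funext e
    by_cases h1 : e = s(x, a₁)
    · simp only [h1, if_true]
    · by_cases h2 : e = s(x, a₂)
      · simp only [h2, hne.symm, if_false, if_true]
      · simp only [h1, h2, if_false, hg e h1 h2]
  have hg1S : ∀ e, e ≠ s(x, a₁) → e ≠ s(x, a₂) → g1 e = gS e := by
    intro e h1 h2; simp only [hg1, hgS, hw1, h1, h2, if_false]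
  have hg2S : ∀ e, e ≠ s(x, a₁) → e ≠ s(x, a₂) → g2 e = gS e := by
    intro e h1 h2; simp only [hg2, hgS, hw2, h1, h2, if_false]
  -- values of the glued weightings on the two relay edges
  have hgS1 : gS s(x, a₁) = w s(x, a₁) := by simp only [hgS, himg a₁ ha₁S, if_false]
  have hgS2 : gS s(x, a₂) = w s(x, a₂) := by simp only [hgS, himg a₂ ha₂S, if_false]
  have hg1e1 : g1 s(x, a₁) = 1 := by simp only [hg1, himg a₁ ha₁S, if_false, hw1, if_true]
  have hg1e2 : g1 s(x, a₂) = π := by simp only [hg1, himg a₂ ha₂S, if_false, hw1, hne.symm, if_true]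
  have hg2e1 : g2 s(x, a₁) = π := by simp only [hg2, himg a₁ ha₁S, if_false, hw2, if_true]
  have hg2e2 : g2 s(x, a₂) = 1 := by simp only [hg2, himg a₂ ha₂S, if_false, hw2, hne.symm, if_false, if_true]
  -- HYPOTHESIS TRANSFER: `τ_{w1}(v) = τ_w(v) = τ_{w2}(v)` for `v ∈ {d, a₁, a₂}`
  have hx1 : ∀ u : Fin n, u ≠ x → u ≠ a₁ → u ≠ a₂ → w1 s(x, u) = 0 := by
    intro u hux hu1 hu2
    have h1 : s(x, u) ≠ s(x, a₁) := fun h => hu1 (by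
      rcases Sym2.eq_iff.1 h with ⟨-, h2⟩ | ⟨-, h2⟩
      · exact h2
      · exact (hux h2).elim)
    have h2 : s(x, u) ≠ s(x, a₂) := fun h => hu2 (by
      rcases Sym2.eq_iff.1 h with ⟨-, h2⟩ | ⟨-, h2⟩
      · exact h2
      · exact (hux h2).elim)
    simp only [hw1, h1, h2, if_false]; exact hx u hux hu1 hu2
  have hx2 : ∀ u : Fin n, u ≠ x → u ≠ a₁ → u ≠ a₂ → w2 s(x, u) = 0 := by
    intro u hux hu1 hu2
    have h1 : s(x, u) ≠ s(x, a₁) := fun h => hu1 (by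
      rcases Sym2.eq_iff.1 h with ⟨-, h2⟩ | ⟨-, h2⟩
      · exact h2
      · exact (hux h2).elim)
    have h2 : s(x, u) ≠ s(x, a₂) := fun h => hu2 (by
      rcases Sym2.eq_iff.1 h with ⟨-, h2⟩ | ⟨-, h2⟩
      · exact h2
      · exact (hux h2).elim)
    simp only [hw2, h1, h2, if_false]; exact hx u hux hu1 hu2
  have hpinw : ∀ σ τ : unitInterval,
      ((fun e => if e = s(x, a₁) then σ else if e = s(x, a₂) then τ else w1 e) =
        fun e => if e = s(x, a₁) then σ else if e = s(x, a₂) then τ else w e) ∧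
      ((fun e => if e = s(x, a₁) then σ else if e = s(x, a₂) then τ else w2 e) =
        fun e => if e = s(x, a₁) then σ else if e = s(x, a₂) then τ else w e) := by
    intro σ τ
    constructor <;> funext e <;> by_cases h1 : e = s(x, a₁)
    · simp only [h1, if_true]
    · by_cases h2 : e = s(x, a₂)
      · simp only [h2, hne.symm, if_false, if_true]
      · simp only [hw1, h1, h2, if_false]
    · simp only [h1, if_true]
    · by_cases h2 : e = s(x, a₂)
      · simp only [h2, hne.symm, if_false, if_true]
      · simp only [hw2, h1, h2, if_false]
  have htransfer : ∀ v : Fin n, v ≠ x →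
      (prodBernoulli w1).real (openConn v b) = (prodBernoulli w).real (openConn v b) ∧
      (prodBernoulli w2).real (openConn v b) = (prodBernoulli w).real (openConn v b) := by
    intro v hvx
    have h0 := al5_twoEdge_tau w x a₁ a₂ v b hvx hbx ha₁x ha₂x h₁₂ hx
    have h1 := al5_twoEdge_tau w1 x a₁ a₂ v b hvx hbx ha₁x ha₂x h₁₂ hx1
    have h2 := al5_twoEdge_tau w2 x a₁ a₂ v b hvx hbx ha₁x ha₂x h₁₂ hx2
    rw [(hpinw 1 1).1, (hpinw 0 0).1] at h1
    rw [(hpinw 1 1).2, (hpinw 0 0).2] at h2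
    have e11 : w1 s(x, a₁) = 1 := by simp only [hw1, if_true]
    have e12 : w1 s(x, a₂) = π := by simp only [hw1, hne.symm, if_false, if_true]
    have e21 : w2 s(x, a₁) = π := by simp only [hw2, if_true]
    have e22 : w2 s(x, a₂) = 1 := by simp only [hw2, hne.symm, if_false, if_true]
    rw [e11, e12] at h1
    rw [e21, e22] at h2
    rw [h0, h1, h2, hπv]
    constructor <;> push_cast <;> ring
  have hle₁' : (prodBernoulli w1).real (openConn d b) ≤ (prodBernoulli w1).real (openConn a₁ b) := by
    rw [(htransfer d hdx).1, (htransfer a₁ ha₁x).1]; exact hle₁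
  have hle₂' : (prodBernoulli w1).real (openConn d b) ≤ (prodBernoulli w1).real (openConn a₂ b) := by
    rw [(htransfer d hdx).1, (htransfer a₂ ha₂x).1]; exact hle₂
  have hle₂'' : (prodBernoulli w2).real (openConn d b) ≤ (prodBernoulli w2).real (openConn a₂ b) := by
    rw [(htransfer d hdx).2, (htransfer a₂ ha₂x).2]; exact hle₂
  -- THE THREE LAYER INEQUALITIES (al5_layer = iterated KN Lemma 5), expanded over the patterns
  have L1 := al5_layer w1 S x d b a₁ hS ha₁x hle₁'
  have L3 := al5_layer w1 S x d b a₂ hS ha₂x hle₂'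
  have L2 := al5_layer w2 S x d b a₂ hS ha₂x hle₂''
  change (prodBernoulli g1).real _ ≤ (prodBernoulli g1).real _ at L1
  change (prodBernoulli g1).real _ ≤ (prodBernoulli g1).real _ at L3
  change (prodBernoulli g2).real _ ≤ (prodBernoulli g2).real _ at L2
  rw [al5_twoEdge_real_inter_U1 g1 x a₁ a₂ ha₂x h₁₂, al5_twoEdge_real_inter_U1 g1 x a₁ a₂ ha₂x h₁₂,
    hpin g1 hg1S 1 1, hpin g1 hg1S 1 0, hg1e1, hg1e2] at L1
  rw [al5_twoEdge_real_inter_U2 g1 x a₁ a₂ ha₂x h₁₂, al5_twoEdge_real_inter_U2 g1 x a₁ a₂ ha₂x h₁₂,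
    hpin g1 hg1S 1 1, hpin g1 hg1S 0 1, hg1e1, hg1e2] at L3
  rw [al5_twoEdge_real_inter_U2 g2 x a₁ a₂ ha₂x h₁₂, al5_twoEdge_real_inter_U2 g2 x a₁ a₂ ha₂x h₁₂,
    hpin g2 hg2S 1 1, hpin g2 hg2S 0 1, hg2e1, hg2e2] at L2
  -- THE MARGIN, expanded over the patterns
  rw [al5_twoEdge_real_inter_R gS x a₁ a₂ ha₂x h₁₂, al5_twoEdge_real_inter_R gS x a₁ a₂ ha₂x h₁₂, hgS1, hgS2]
  -- bookkeeping: name the pattern quantities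
  set X11 := (prodBernoulli g11).real (openConn x b) with hX11
  set D11 := (prodBernoulli g11).real (openConn d b) with hD11
  set X10 := (prodBernoulli g10).real (openConn x b) with hX10
  set D10 := (prodBernoulli g10).real (openConn d b) with hD10
  set X01 := (prodBernoulli g01).real (openConn x b) with hX01
  set D01 := (prodBernoulli g01).real (openConn d b) with hD01
  have hp1 : 0 ≤ (w s(x, a₁) : ℝ) := unitInterval.nonneg _
  have hp1' : (w s(x, a₁) : ℝ) ≤ 1 := unitInterval.le_one _
  have hp2 : 0 ≤ (w s(x, a₂) : ℝ) := unitInterval.nonneg _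
  have hp2' : (w s(x, a₂) : ℝ) ≤ 1 := unitInterval.le_one _
  simp only [hπv, Set.Icc.coe_one] at L1 L2 L3
  have hL1 := sub_nonneg.2 L1
  have hL2 := sub_nonneg.2 L2
  have hL3 := sub_nonneg.2 L3
  rw [← sub_nonneg]
  -- conclude by the identity `(1-π)·margin = p₁(1-p₂) L₁ + p₂(1-p₁) L₂ + (1-p₁)(1-p₂)·πΔ¹¹`
  by_cases hπ1 : (w s(x, a₁) : ℝ) * (w s(x, a₂) : ℝ) < 1
  · nlinarith [mul_nonneg (mul_nonneg hp1 (sub_nonneg.2 hp2')) hL1,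
      mul_nonneg (mul_nonneg hp2 (sub_nonneg.2 hp1')) hL2,
      mul_nonneg (mul_nonneg (sub_nonneg.2 hp1') (sub_nonneg.2 hp2')) hL3, sub_pos.2 hπ1,
      mul_nonneg hp1 hp2]
  · have h11 : (w s(x, a₁) : ℝ) = 1 := le_antisymm hp1' (by nlinarith [mul_nonneg hp1 (sub_nonneg.2 hp2')])
    have h22 : (w s(x, a₂) : ℝ) = 1 := le_antisymm hp2' (by nlinarith [mul_nonneg hp2 (sub_nonneg.2 hp1')])
    rw [h11, h22] at hL3 ⊢
    nlinarith [hL3]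

/-- **AL5 for every block when the relay neighbours of the bystander are `d` itself and two others** (corollary of
`al5_twoRelays` by the strip reductions): `T = {d, a₁, a₂}`, the bystander `x` has no pair of positive weight in `w` other than
`s(x,d)`, `s(x,a₁)`, `s(x,a₂)` (virtual block star), `w s(x,d) < 1`, `d ∉ S`.  Then
`μ_{w^S}(R ∩ {d ↔ b}) ≤ μ_{w^S}(R ∩ {x ↔ b})`.  (In the crux's use the designated relay `a₀ = d` IS usually a neighbour of the
bystander.)  Proof: drop `d` from `T` (`al5_dropRelay`), strip the edge `x–d` (`al5_of_strip_edge`, hypothesis transferred by the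
dual Lemma 5 `al5_hyp_delete_edge_at_d`), apply `al5_twoRelays`. [cite: KozmaNitzan2024, Lemma 3(ii) (pp. 6–7), Lemma 5 (p. 13)] -/
theorem al5_twoRelays_and_d (w : Sym2 (Fin n) → unitInterval) (S : Finset (Fin n)) (x d b a₁ a₂ : Fin n)
    (hS : ∀ y ∈ S, y ≠ x) (ha₁x : a₁ ≠ x) (ha₂x : a₂ ≠ x) (h₁₂ : a₁ ≠ a₂) (ha₁S : a₁ ∉ S) (ha₂S : a₂ ∉ S)
    (hdx : d ≠ x) (hbx : b ≠ x) (hdS : d ∉ S) (hd₁ : d ≠ a₁) (hd₂ : d ≠ a₂) (hxd : (w s(x, d) : ℝ) < 1)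
    (hx : ∀ u : Fin n, u ≠ x → u ≠ a₁ → u ≠ a₂ → u ≠ d → w s(x, u) = 0)
    (hle₁ : (prodBernoulli w).real (openConn d b) ≤ (prodBernoulli w).real (openConn a₁ b))
    (hle₂ : (prodBernoulli w).real (openConn d b) ≤ (prodBernoulli w).real (openConn a₂ b)) :
    (prodBernoulli (fun e : Sym2 (Fin n) => if e ∈ S.image (fun y => s(x, y)) then 1 else w e)).real
        ({ω : Set (Sym2 (Fin n)) | ∃ a ∈ ({d, a₁, a₂} : Finset (Fin n)), s(x, a) ∈ ω} ∩ openConn d b) ≤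
      (prodBernoulli (fun e : Sym2 (Fin n) => if e ∈ S.image (fun y => s(x, y)) then 1 else w e)).real
        ({ω : Set (Sym2 (Fin n)) | ∃ a ∈ ({d, a₁, a₂} : Finset (Fin n)), s(x, a) ∈ ω} ∩ openConn x b) := by
  -- drop `d` from the relay set
  refine al5_dropRelay _ _ x d b hdx ?_
  have herase : ({d, a₁, a₂} : Finset (Fin n)).erase d = {a₁, a₂} := by
    ext v
    simp only [Finset.mem_erase, Finset.mem_insert, Finset.mem_singleton]
    constructor
    · rintro ⟨hv, h | h | h⟩
      · exact (hv h).elim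
      · exact Or.inl h
      · exact Or.inr h
    · rintro (h | h)
      · exact ⟨h ▸ hd₁.symm, Or.inr (Or.inl h)⟩
      · exact ⟨h ▸ hd₂.symm, Or.inr (Or.inr h)⟩
  rw [herase]
  -- strip the edge `x–d`
  refine al5_of_strip_edge w S {a₁, a₂} x d b x hS hdx hdS (Or.inl rfl) ?_
  -- the stripped weighting is the glued star of `w' = w[s(x,d) ↦ 0]`
  set w' : Sym2 (Fin n) → unitInterval := fun e => if e = s(d, x) then 0 else w e with hw'
  have hxdS : s(x, d) ∉ S.image (fun y => s(x, y)) := by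
    intro hmem
    obtain ⟨y, hyS, hy⟩ := Finset.mem_image.1 hmem
    rcases Sym2.eq_iff.1 hy with ⟨-, h2⟩ | ⟨-, h2⟩
    · exact hdS (h2 ▸ hyS)
    · exact hS y hyS h2
  have hfun : (fun e' : Sym2 (Fin n) => if e' = s(x, d) then (0 : unitInterval) else
      (if e' ∈ S.image (fun y => s(x, y)) then 1 else w e')) =
      fun e => if e ∈ S.image (fun y => s(x, y)) then 1 else w' e := by
    funext e
    by_cases h1 : e = s(x, d)
    · subst h1
      simp only [if_true, hxdS, if_false, hw', Sym2.eq_swap]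
    · have h1' : e ≠ s(d, x) := by rwa [Sym2.eq_swap]
      simp only [h1, if_false, hw', h1']
  rw [hfun]
  -- hypotheses for `w'` (dual Lemma 5) and structure of `x` in `w'`
  have hxd' : (w s(d, x) : ℝ) < 1 := by rwa [Sym2.eq_swap]
  have hle₁' := al5_hyp_delete_edge_at_d w d x a₁ b hdx.symm hxd' hle₁
  have hle₂' := al5_hyp_delete_edge_at_d w d x a₂ b hdx.symm hxd' hle₂
  have hx' : ∀ u : Fin n, u ≠ x → u ≠ a₁ → u ≠ a₂ → w' s(x, u) = 0 := by
    intro u hux hu1 hu2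
    by_cases hud : u = d
    · subst hud; simp only [hw', Sym2.eq_swap, if_true]
    · have hne : s(x, u) ≠ s(d, x) := by
        intro h
        rcases Sym2.eq_iff.1 h with ⟨h1, -⟩ | ⟨-, h2⟩
        · exact hdx h1.symm
        · exact hud h2
      simp only [hw', hne, if_false]
      exact hx u hux hu1 hu2 hud
  exact al5_twoRelays w' S x d b a₁ a₂ hS ha₁x ha₂x h₁₂ ha₁S ha₂S hdx hbx hx' hle₁' hle₂'

end AL5TwoRelays

end

end Summit.CriticalPhenomena.PercolationContinuityZ3.Theorems
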